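import Mathlib
import HarnessLib
import Summits.Parity.GeneralizedHardyLittlewood.Theorems.ModelHyperbolicity.Negative.ModelHyperbolicityNotMonotone

/-!
# Crux `FibreHyperbolicity` (stmt-Parity-14108), line `SketchIdeator1` (model transfer):
# the perturbation lemma `stub_perturb`

`stub_perturb` (`PerturbLemma`, unfolded): if a nonzero real polynomial `Q` of degree `d` has `d`
distinct real roots, then there is `ε > 0` such that every real polynomial `q` of degree `≤ d + 1`
whose coefficients are `ε`-close to those of `Q` has only real complex zeros.

Proof (Hurwitz by the intermediate value theorem). Sort the roots `r₀ < ⋯ < r_{d-1}` of `Q` and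
interleave them with `d + 1` points `s₀ < r₀ < s₁ < ⋯ < r_{d-1} < s_d`. Writing
`Q = lc · ∏ (X - rᵢ)`, the product `Q(sₖ) Q(sₖ₊₁) = lc² ∏ᵢ (sₖ - rᵢ)(sₖ₊₁ - rᵢ)` has exactly one
negative factor (`i = k`), so `Q` alternates strictly in sign along `s`, with margin
`δ = minₖ |Q(sₖ)| > 0`. A coefficientwise `ε`-perturbation `q` of degree `≤ d + 1` moves `q(sₖ)` by at
most `ε · Σ_{n ≤ d+1} |sₖ|ⁿ < δ` for `ε = δ / (M + 1)`, `M = Σₖ Σ_{n ≤ d+1} |sₖ|ⁿ`, so `q ≠ 0` alternates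
too and has `≥ d` real roots (`le_card_roots_of_alternating`). Finally a real polynomial whose degree
exceeds its real-root count by at most one is split over `ℝ` (the rootless cofactor of `∏ (X - root)`
has degree `≤ 1`, hence is constant), so all zeros of `q` are real
(`im_eq_zero_of_natDegree_le_card_roots`).
-/

namespace Summit.Parity.GeneralizedHardyLittlewood.Cruxes.FibreHyperbolicity.ModelTransfer

open Finset Polynomial
open scoped BigOperators Classical
open Summit.Parity.GeneralizedHardyLittlewood.Theorems.ModelHyperbolicity.Negative
  (im_eq_zero_of_natDegree_le_card_roots le_card_roots_of_alternating)

/-- A real polynomial whose degree exceeds its number of real roots (with multiplicity) by at most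
one has exactly as many real roots as its degree: the rootless cofactor of `∏ (X - r)` has degree
`≤ 1`, and a real polynomial of degree `1` has a root. -/
private theorem natDegree_le_card_roots_of_le_succ {p : ℝ[X]}
    (h : p.natDegree ≤ p.roots.card + 1) : p.natDegree ≤ p.roots.card := by
  obtain ⟨q, -, hdeg, hroots⟩ := p.exists_prod_multiset_X_sub_C_mul
  have hq1 : q.natDegree ≤ 1 := by omega
  by_contra hlt
  have hq : q.natDegree = 1 := by omega
  obtain ⟨a, b, rfl⟩ : ∃ a b : ℝ, q = C a * X + C b := ⟨_, _, eq_X_add_C_of_natDegree_le_one hq1⟩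
  have ha : a ≠ 0 := by
    rintro rfl
    simp at hq
  have hq0 : C a * X + C b ≠ 0 := by
    intro h0
    rw [h0, natDegree_zero] at hq
    omega
  have hroot : -b / a ∈ (C a * X + C b).roots := by
    rw [mem_roots hq0, IsRoot.def]
    simp only [eval_add, eval_mul, eval_C, eval_X]
    field_simp
    ring
  rw [hroots] at hroot
  exact Multiset.notMem_zero _ hroot

/-- If `x` is closer to `y` than `|y|`, then `x` and `y` have the same strict sign. -/
private theorem mul_pos_of_abs_sub_lt {x y : ℝ} (h : |x - y| < |y|) : 0 < x * y := by
  rcases lt_trichotomy y 0 with hy | hy | hy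
  · rw [abs_of_neg hy, abs_sub_lt_iff] at h
    exact mul_pos_of_neg_of_neg (by linarith) hy
  · rw [hy, abs_zero] at h
    exact absurd h (not_lt.mpr (abs_nonneg _))
  · rw [abs_of_pos hy, abs_sub_lt_iff] at h
    exact mul_pos (by linarith) hy

/-- Coefficientwise `ε`-close real polynomials of degree `< N` are `ε · Σ_{n<N} |x|ⁿ`-close at `x`. -/
private theorem abs_eval_sub_eval_le {p q : ℝ[X]} {N : ℕ} {ε : ℝ} (hp : p.natDegree < N)
    (hq : q.natDegree < N) (hε : ∀ n : ℕ, |p.coeff n - q.coeff n| ≤ ε) (x : ℝ) :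
    |p.eval x - q.eval x| ≤ ε * ∑ n ∈ range N, |x| ^ n := by
  have hpq : (p - q).natDegree < N := lt_of_le_of_lt (natDegree_sub_le p q) (max_lt hp hq)
  rw [← eval_sub, eval_eq_sum_range' hpq, mul_sum]
  refine (abs_sum_le_sum_abs _ _).trans (sum_le_sum fun n _ => ?_)
  rw [abs_mul, abs_pow, coeff_sub]
  exact mul_le_mul_of_nonneg_right (hε n) (pow_nonneg (abs_nonneg _) _)

/-- **Perturbation lemma** (`PerturbLemma`, unfolded; Hurwitz by IVT). If a nonzero real polynomial
`Q` has `natDegree Q` distinct real roots, then for some `ε > 0` every real polynomial `q` with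
`natDegree q ≤ natDegree Q + 1` and all coefficients within `ε` of those of `Q` has only real zeros. -/
theorem stub_perturb :
    ∀ Q : ℝ[X], Q ≠ 0 → Q.natDegree ≤ Q.roots.toFinset.card →
      ∃ ε : ℝ, 0 < ε ∧ ∀ q : ℝ[X], q.natDegree ≤ Q.natDegree + 1 →
        (∀ n : ℕ, |q.coeff n - Q.coeff n| ≤ ε) →
        ∀ z : ℂ, (q.map (algebraMap ℝ ℂ)).eval z = 0 → z.im = 0 := by
  intro Q hQ hcardle
  set d := Q.natDegree with hd
  set S := Q.roots.toFinset with hS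
  -- the roots are simple: `S.val = Q.roots`, `S.card = d`, and `Q = lc • ∏_{a ∈ S} (X - a)`
  have hcardS : S.card = d :=
    le_antisymm ((Multiset.toFinset_card_le _).trans (card_roots' Q)) hcardle
  have hval : S.val = Q.roots := by
    refine Multiset.eq_of_le_of_card_le ?_ ?_
    · rw [hS, Multiset.toFinset_val]
      exact Multiset.dedup_le _
    · rw [Finset.card_val, hcardS]
      exact card_roots' Q
  have hprod : C Q.leadingCoeff * (Q.roots.map fun a => X - C a).prod = Q :=
    C_leadingCoeff_mul_prod_multiset_X_sub_C (by rw [← hval, Finset.card_val, hcardS])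
  have heval : ∀ x : ℝ, Q.eval x = Q.leadingCoeff * ∏ a ∈ S, (x - a) := by
    intro x
    conv_lhs => rw [← hprod]
    rw [eval_mul, eval_C, eval_multiset_prod, Multiset.map_map, Finset.prod_eq_multiset_prod, ← hval]
    simp only [Function.comp_def, eval_sub, eval_X, eval_C]
  -- sort the roots increasingly (`r`), bound them strictly above (`T`), extend `r` to a strictly
  -- increasing sequence `R` on `ℕ`, and interleave (`s`)
  obtain ⟨r, hrmem, hrS⟩ : ∃ r : Fin d ↪o ℝ, (∀ i, r i ∈ S) ∧ ∀ a ∈ S, ∃ i, r i = a :=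
    ⟨S.orderEmbOfFin hcardS, S.orderEmbOfFin_mem hcardS, fun a ha => by
      rw [← Set.mem_range, Finset.range_orderEmbOfFin, Finset.mem_coe]; exact ha⟩
  obtain ⟨T, hltT⟩ : ∃ T : ℝ, ∀ a ∈ S, a < T :=
    ⟨1 + ∑ a ∈ S, |a|, fun a ha => by
      have h1 : |a| ≤ ∑ b ∈ S, |b| := Finset.single_le_sum (fun b _ => abs_nonneg b) ha
      have h2 : a ≤ |a| := le_abs_self a
      linarith⟩
  obtain ⟨R, hRr, hRmono⟩ : ∃ R : ℕ → ℝ, (∀ i : Fin d, R i = r i) ∧ StrictMono R := by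
    refine ⟨fun i => if h : i < d then r ⟨i, h⟩ else T + i, fun i => by simp, ?_⟩
    refine strictMono_nat_of_lt_succ fun i => ?_
    by_cases h1 : i + 1 < d
    · simp only [dif_pos (Nat.lt_of_succ_lt h1), dif_pos h1]
      exact r.strictMono (Fin.mk_lt_mk.mpr (Nat.lt_succ_self i))
    · by_cases h0 : i < d
      · simp only [dif_pos h0, dif_neg h1]
        have := hltT _ (hrmem ⟨i, h0⟩)
        have : (0 : ℝ) ≤ ((i + 1 : ℕ) : ℝ) := Nat.cast_nonneg _
        linarith
      · simp only [dif_neg h0, dif_neg h1]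
        push_cast
        linarith
  obtain ⟨s, hs_lt, hs_gt⟩ : ∃ s : ℕ → ℝ, (∀ i k, i < k → R i < s k) ∧ ∀ i k, k ≤ i → s k < R i := by
    refine ⟨fun k => if k = 0 then R 0 - 1 else (R (k - 1) + R k) / 2, fun i k hik => ?_,
      fun i k hki => ?_⟩
    · have hk : k ≠ 0 := by omega
      simp only [if_neg hk]
      have h1 : R i ≤ R (k - 1) := hRmono.monotone (by omega)
      have h2 : R (k - 1) < R k := hRmono (by omega)
      linarith
    · have h1 : R k ≤ R i := hRmono.monotone hki
      by_cases hk : k = 0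
      · simp only [if_pos hk]
        subst hk
        linarith
      · simp only [if_neg hk]
        have h2 : R (k - 1) < R k := hRmono (by omega)
        linarith
  have hs_mono : ∀ k, s k < s (k + 1) := fun k =>
    (hs_gt k k le_rfl).trans (hs_lt k (k + 1) (Nat.lt_succ_self k))
  -- `Q` does not vanish at the points `s k` …
  have hlc : Q.leadingCoeff ≠ 0 := leadingCoeff_ne_zero.mpr hQ
  have hne : ∀ k, Q.eval (s k) ≠ 0 := by
    intro k
    rw [heval]
    refine mul_ne_zero hlc (Finset.prod_ne_zero_iff.mpr fun a ha => ?_)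
    obtain ⟨i, rfl⟩ := hrS a ha
    rw [← hRr i]
    rcases lt_or_ge (i : ℕ) k with hik | hki
    · exact (sub_pos.mpr (hs_lt i k hik)).ne'
    · exact (sub_neg.mpr (hs_gt i k hki)).ne
  -- … and alternates strictly in sign along them
  have halt : ∀ k < d, Q.eval (s k) * Q.eval (s (k + 1)) < 0 := by
    intro k hk
    rw [heval, heval, mul_mul_mul_comm, ← Finset.prod_mul_distrib]
    refine mul_neg_of_pos_of_neg (mul_self_pos.mpr hlc) ?_
    have hmem : r ⟨k, hk⟩ ∈ S := hrmem ⟨k, hk⟩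
    rw [← Finset.mul_prod_erase S _ hmem]
    refine mul_neg_of_neg_of_pos ?_ (Finset.prod_pos fun a ha => ?_)
    · have h1 : s k < R k := hs_gt k k le_rfl
      have h2 : R k < s (k + 1) := hs_lt k (k + 1) (Nat.lt_succ_self k)
      rw [hRr ⟨k, hk⟩] at h1 h2
      exact mul_neg_of_neg_of_pos (sub_neg.mpr h1) (sub_pos.mpr h2)
    · obtain ⟨ha', haS⟩ := Finset.mem_erase.mp ha
      obtain ⟨i, rfl⟩ := hrS a haS
      have hik : (i : ℕ) ≠ k := fun h => ha' (congrArg r (Fin.ext h))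
      rw [← hRr i]
      rcases lt_or_gt_of_ne hik with hik | hik
      · exact mul_pos (sub_pos.mpr (hs_lt i k hik)) (sub_pos.mpr (hs_lt i (k + 1) (by omega)))
      · exact mul_pos_of_neg_of_neg (sub_neg.mpr (hs_gt i k (by omega)))
          (sub_neg.mpr (hs_gt i (k + 1) (by omega)))
  -- the margin `δ = min_{k ≤ d} |Q (s k)|` and the size `M = Σ_{k ≤ d} Σ_{n ≤ d+1} |s k|ⁿ`
  obtain ⟨k₀, -, hk₀⟩ :=
    Finset.exists_min_image (Finset.range (d + 1)) (fun k => |Q.eval (s k)|) ⟨0, by simp⟩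
  have hδpos : 0 < |Q.eval (s k₀)| := abs_pos.mpr (hne k₀)
  set M : ℝ := ∑ k ∈ Finset.range (d + 1), ∑ n ∈ Finset.range (d + 2), |s k| ^ n with hM
  have hM0 : 0 ≤ M :=
    Finset.sum_nonneg fun k _ => Finset.sum_nonneg fun n _ => pow_nonneg (abs_nonneg _) _
  have hMk : ∀ k ∈ Finset.range (d + 1), ∑ n ∈ Finset.range (d + 2), |s k| ^ n ≤ M := fun k hk =>
    Finset.single_le_sum (f := fun k => ∑ n ∈ Finset.range (d + 2), |s k| ^ n)
      (fun k _ => Finset.sum_nonneg fun n _ => pow_nonneg (abs_nonneg _) _) hk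
  have hεpos : 0 < |Q.eval (s k₀)| / (M + 1) := div_pos hδpos (by linarith)
  refine ⟨|Q.eval (s k₀)| / (M + 1), hεpos, fun q hqdeg hqε z hz => ?_⟩
  -- `q` has the strict sign of `Q` at each `s k`, `k ≤ d`
  have hclose : ∀ k ∈ Finset.range (d + 1), 0 < q.eval (s k) * Q.eval (s k) := by
    intro k hk
    refine mul_pos_of_abs_sub_lt (lt_of_lt_of_le ?_ (hk₀ k hk))
    calc |q.eval (s k) - Q.eval (s k)|
        ≤ |Q.eval (s k₀)| / (M + 1) * ∑ n ∈ Finset.range (d + 2), |s k| ^ n :=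
          abs_eval_sub_eval_le (by omega) (by omega) hqε (s k)
      _ ≤ |Q.eval (s k₀)| / (M + 1) * M := mul_le_mul_of_nonneg_left (hMk k hk) hεpos.le
      _ < |Q.eval (s k₀)| := by
          rw [div_mul_eq_mul_div, div_lt_iff₀ (by linarith : (0 : ℝ) < M + 1)]
          exact mul_lt_mul_of_pos_left (by linarith) hδpos
  -- hence `q ≠ 0` alternates strictly in sign along `s 0 < ⋯ < s d`: `d ≤ #roots q`
  have hq0 : q ≠ 0 := by
    rintro rfl
    have := hclose 0 (by simp)
    simp at this
  have hqalt : ∀ k < d, q.eval (s k) * q.eval (s (k + 1)) < 0 := by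
    intro k hk
    have h1 := hclose k (Finset.mem_range.mpr (by omega))
    have h2 := hclose (k + 1) (Finset.mem_range.mpr (by omega))
    have h3 := halt k hk
    refine lt_of_not_ge fun h => ?_
    nlinarith [mul_pos h1 h2, mul_nonpos_of_nonneg_of_nonpos h h3.le]
  have hdle : d ≤ q.roots.card := le_card_roots_of_alternating q s (fun k _ => hs_mono k) hqalt hq0
  -- a real polynomial with `deg ≤ #roots + 1` has `deg ≤ #roots`: all zeros of `q` are real
  exact im_eq_zero_of_natDegree_le_card_roots hq0 (natDegree_le_card_roots_of_le_succ (by omega)) hz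

end Summit.Parity.GeneralizedHardyLittlewood.Cruxes.FibreHyperbolicity.ModelTransfer
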